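import Mathlib
import Literature.Computability.AlgebraicComplexity.FS13SpanDimensionReduction
import Literature.Computability.AlgebraicComplexity.FS13GeneratorRecursion
import HarnessLib

/-!
# Forbes–Shpilka 2013, Lemma 3.19 (arXiv Lemma 19) "span preserving", for FSV's generator (7.1)
# with the SAFE degree parameter — proof, no named facts

M. A. Forbes, A. Shpilka, *Quasipolynomial-time identity testing of non-commutative and read-once
oblivious algebraic branching programs*, FOCS 2013 = arXiv:1209.2408 [ForbesShpilka2013], §3.2,
Lemma "The generator preserves span" (arXiv Lemma 19, paper:arxiv-1209.2408 p0016.txt:L31–L62):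

> Let `M_b ∈ 𝔽[x_b]^{r×r}` for `b ∈ {0,1}^d` be of degree `< n`. Then
> `span{∏_b M_b(x_b)}_{x ∈ 𝔽^{2^d}} = span{∏_b M_b(𝒢_{d,b}(α))}_{α ∈ 𝔽^{d+1}}`.

Typed for the tree's rendering `fsGenCoord n w (d+1) ω β` of FSV 2018 eq. (7.1) (individual
degree `≤ d` = FS13's strict bound `n_FS13 = d + 1`: the SAFE reading of FSV Lemma 55, val-lit
ruling (23) / PRINT-ERRATA B13), layers `M_j ∈ K[X]^{w×w}` of `natDegree ≤ d` in FSV's binary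
variable order (`binaryOrder`), over an INFINITE field `K` (print: "`|𝔽| > (Dnr³)²`"; the
consumer base-changes), with `1, ω, …` distinct below `(2ⁿ(d+1)w²)²` and `ω ≠ 0`, `β` injective.
PROVED in the strengthened form the printed induction actually uses ("We will prove this claim for
each fixed value of the variables `α⃗`"): for every finite family of layer sequences there is a
COMMON seed prefix `α' ∈ K^n` such that already the one-parameter family in the LAST seed spans:
`span{∏_j M_j(x_j)}_x ⊆ span{∏_j M_j(𝒢^{(n)}_j(α', s))}_{s ∈ K}` (`span_layerProd_le_span_lastSeed`);
the printed two-sided statement over all seeds follows (`span_layerProd_eq_span_generator`).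
Ingredients, all from the tree: the split `𝓜 = 𝓜₀𝓜₁` and the recursion/nodes/degree facts of
`FS13GeneratorRecursion.lean`, Lemma 3.2 (`Submodule.span_mul_span`) and the merging Lemma 3.6
(`FS2013.card_lt_of_not_span_evalProd_le`) of `FS13SpanDimensionReduction.lean`.
A step towards the named fact `ForbesShpilkaVolk2018_lemma55` (safe reading: what remains is
Lemma 3.20 "generator" + the base change); nothing here bears on `VP ≠ VNP`.

## References
* [ForbesShpilka2013] arXiv:1209.2408 §3.2 Lemma 19 (arXiv numbering) (locator:
  paper:arxiv-1209.2408 p0016.txt:L31–L62).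
* [ForbesShpilkaVolk2018] Lemma 55 eq. (7.1) (seq.; = ToC Lemma 7.1).
-/

noncomputable section

open MvPolynomial Finset

open scoped BigOperators Pointwise

namespace Literature.Computability.AlgebraicComplexity

namespace FS2013

variable {K : Type*} [Field K]

/-- `j < 2ⁿ ⇒ j < 2ⁿ⁺¹`. [folklore] -/
private theorem lt_two_pow_succ {n j : ℕ} (hj : j < 2 ^ n) : j < 2 ^ (n + 1) :=
  lt_of_lt_of_le hj (Nat.pow_le_pow_right (by norm_num) (Nat.le_succ n))

/-- `j < 2ⁿ ⇒ 2ⁿ + j < 2ⁿ⁺¹`. [folklore] -/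
private theorem add_lt_two_pow_succ {n j : ℕ} (hj : j < 2 ^ n) : 2 ^ n + j < 2 ^ (n + 1) := by
  rw [pow_succ]; omega

/-- A set all of whose finite subsets have `< B` elements is finite. [folklore] -/
private theorem set_finite_of_card_lt {L : Type*} {B : ℕ} (s : Set L)
    (h : ∀ S : Finset L, ↑S ⊆ s → S.card < B) : s.Finite := by
  by_contra hs
  obtain ⟨S, hS, hcard⟩ := Set.Infinite.exists_subset_card_eq hs B
  exact absurd (h S hS) (by rw [hcard]; exact lt_irrefl B)

/-- **[ForbesShpilka2013, Lemma 19 (arXiv), "span preserving" — strengthened working form].**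
For every finite family of `2ⁿ`-layer sequences of degree `≤ d` there is a common seed prefix
`α' ∈ K^n` such that for each member the products along the generator's LAST-seed curve already
span all products of evaluations:
`span{∏_j M_j(x_j)}_{x ∈ K^{2ⁿ}} ⊆ span{∏_j M_j(𝒢^{(n)}_j(α', s))}_{s ∈ K}`.
[cite: ForbesShpilka2013, Lemma 19 (arXiv numbering; §3.2), proof (induction on `d`; "We will prove
this claim for each fixed value of the variables `α⃗`")] locator: paper:arxiv-1209.2408 p0016.txt:L31–L62 -/
theorem span_layerProd_le_span_lastSeed [Infinite K] {w d : ℕ} (hw : 0 < w) {ω : K} (hω0 : ω ≠ 0)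
    {β : Fin (w ^ 2) → K} (hβ : Function.Injective β) :
    ∀ (n : ℕ), Set.InjOn (fun k : ℕ => ω ^ k)
        (Set.Iio ((2 ^ n * (d + 1) * w ^ 2) * (2 ^ n * (d + 1) * w ^ 2))) →
      ∀ (ι : Type) [Fintype ι] (Ms : ι → Fin (2 ^ n) → Matrix (Fin w) (Fin w) (Polynomial K)),
        (∀ t j a b, (Ms t j a b).natDegree ≤ d) →
        ∃ α' : Fin n → K, ∀ t,
          Submodule.span K (Set.range fun x : Fin (2 ^ n) → K =>
              (List.ofFn fun j => (Ms t j).map (Polynomial.eval (x j))).prod) ≤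
          Submodule.span K (Set.range fun s : K =>
              (List.ofFn fun j => (Ms t j).map (Polynomial.eval
                (MvPolynomial.eval (Fin.snoc α' s : Fin (n + 1) → K)
                  (fsGenCoord n w (d + 1) ω β (binaryOrder n j))))).prod) := by
  classical
  intro n
  induction n with
  | zero =>
    intro _ ι _ Ms _
    refine ⟨Fin.elim0, fun t => Submodule.span_mono ?_⟩
    rintro _ ⟨x, rfl⟩
    have hj0 : ∀ j : Fin (2 ^ 0), j = ⟨0, by norm_num⟩ := fun j => Fin.ext (by
      have := j.isLt; simp only [pow_zero] at this; omega)
    refine ⟨x ⟨0, by norm_num⟩, ?_⟩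
    simp only
    congr 1
    congr 1
    funext j
    congr 2
    rw [fsGenCoord_zero, MvPolynomial.eval_X, hj0 j]
    exact Fin.snoc_last (α := fun _ => K) _ _
  | succ n ih =>
    intro hω ι _ Ms hMs
    -- numerology: `E = 2ⁿ(d+1)w²` bounds the degree of a half product composed with the curves
    have hEle : 2 ^ n * (d + 1) * w ^ 2 ≤ 2 ^ (n + 1) * (d + 1) * w ^ 2 := by
      rw [pow_succ]
      exact Nat.mul_le_mul_right _ (Nat.mul_le_mul_right _ (Nat.le_mul_of_pos_right _ two_pos))
    have hω' : Set.InjOn (fun k : ℕ => ω ^ k)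
        (Set.Iio ((2 ^ n * (d + 1) * w ^ 2) * (2 ^ n * (d + 1) * w ^ 2))) :=
      hω.mono (Set.Iio_subset_Iio (Nat.mul_le_mul hEle hEle))
    -- induction hypothesis for the `2|ι|` half-sequences (last bit `0`: first half; `1`: second)
    obtain ⟨α'', hα''⟩ := ih hω' (ι ⊕ ι)
      (Sum.elim (fun t j => Ms t ⟨j, lt_two_pow_succ j.isLt⟩)
        (fun t j => Ms t ⟨2 ^ n + j, add_lt_two_pow_succ j.isLt⟩)) (by
      rintro (t | t) j a b
      · exact hMs t _ a b
      · exact hMs t _ a b)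
    -- the curves `f_j(s) = 𝒢^{(n)}_j(α'', s)` of degree `≤ w²`
    obtain ⟨f, hf_eval, hf_deg⟩ : ∃ f : Fin (2 ^ n) → Polynomial K,
        (∀ j s, (f j).eval s = MvPolynomial.eval (Fin.snoc α'' s : Fin (n + 1) → K)
          (fsGenCoord n w (d + 1) ω β (binaryOrder n j))) ∧
        ∀ j, (f j).natDegree ≤ w ^ 2 :=
      ⟨fun j => MvPolynomial.aeval (Fin.snoc (fun i : Fin n => Polynomial.C (α'' i)) Polynomial.X :
          Fin (n + 1) → Polynomial K) (fsGenCoord n w (d + 1) ω β (binaryOrder n j)),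
        fun j s => eval_aeval_snoc_C_X α'' _ s,
        fun j => natDegree_fsGenCoord_lastCurve_le hw n (d + 1) ω β (binaryOrder n j) α''⟩
    -- `R(x) = ∏_j M_{(j,0)}(f_j(x))`, `T(y) = ∏_j M_{(j,1)}(f_j(y))`: degree `< E`, right values
    have hmk : ∀ (N : Fin (2 ^ n) → Matrix (Fin w) (Fin w) (Polynomial K)),
        (∀ j a b, (N j a b).natDegree ≤ d) →
        ∃ R : Matrix (Fin w) (Fin w) (Polynomial K),
          (∀ a b, (R a b).natDegree < 2 ^ n * (d + 1) * w ^ 2) ∧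
          ∀ s : K, R.map (Polynomial.eval s) = (List.ofFn fun j => (N j).map (Polynomial.eval
            (MvPolynomial.eval (Fin.snoc α'' s : Fin (n + 1) → K)
              (fsGenCoord n w (d + 1) ω β (binaryOrder n j))))).prod := by
      intro N hN
      refine ⟨(List.ofFn fun j => (N j).map fun p => p.comp (f j)).prod, fun a b => ?_, fun s => ?_⟩
      · have h1 := natDegree_listProd_ofFn_le (2 ^ n) (fun j => (N j).map fun p => p.comp (f j))
          (d * w ^ 2) (fun j a b => natDegree_map_comp_le (N j) (f j) (hN j) (hf_deg j) a b) a b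
        refine lt_of_le_of_lt h1 ?_
        rw [mul_assoc]
        refine Nat.mul_lt_mul_of_pos_left ?_ (Nat.pos_of_ne_zero (by positivity))
        rw [Nat.succ_mul]
        exact Nat.lt_add_of_pos_right (pow_pos hw 2)
      · rw [← Polynomial.coe_evalRingHom, map_listProd_ofFn]
        refine congrArg (fun F : Fin (2 ^ n) → Matrix (Fin w) (Fin w) K => (List.ofFn F).prod)
          (funext fun j => ?_)
        rw [Polynomial.coe_evalRingHom, map_comp_map_eval, hf_eval]
    choose Rf hRdeg hReval using fun t => hmk (fun j => Ms t ⟨j, lt_two_pow_succ j.isLt⟩)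
      (fun j => hMs t _)
    choose Tf hTdeg hTeval using fun t => hmk (fun j => Ms t ⟨2 ^ n + j, add_lt_two_pow_succ j.isLt⟩)
      (fun j => hMs t _)
    -- the curves of level `n+1` through the evaluation points (`U(β_ℓ) = R(ω^ℓ α)`, …)
    have hnode0 : ∀ (α : K) (ℓ : Fin (w ^ 2)) (j : Fin (2 ^ n)),
        MvPolynomial.eval (Fin.snoc (Fin.snoc α'' (ω⁻¹ * α) : Fin (n + 1) → K) (β ℓ) :
            Fin (n + 2) → K)
          (fsGenCoord (n + 1) w (d + 1) ω β (binaryOrder (n + 1) ⟨j, lt_two_pow_succ j.isLt⟩)) =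
        MvPolynomial.eval (Fin.snoc α'' (ω ^ (ℓ : ℕ) * α) : Fin (n + 1) → K)
          (fsGenCoord n w (d + 1) ω β (binaryOrder n j)) := by
      intro α ℓ j
      rw [eval_fsGenCoord_succ_node n w (d + 1) ω β hβ
        (binaryOrder (n + 1) ⟨j, lt_two_pow_succ j.isLt⟩) (binaryOrder n j)
        (fun i => (binaryOrder_succ_lower j i).symm) α'' (ω⁻¹ * α) ℓ,
        if_pos (binaryOrder_succ_lower_last j), pow_succ, mul_assoc, mul_inv_cancel_left₀ hω0]
    have hnode1 : ∀ (α : K) (ℓ : Fin (w ^ 2)) (j : Fin (2 ^ n)),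
        MvPolynomial.eval (Fin.snoc (Fin.snoc α'' (ω⁻¹ * α) : Fin (n + 1) → K) (β ℓ) :
            Fin (n + 2) → K)
          (fsGenCoord (n + 1) w (d + 1) ω β
            (binaryOrder (n + 1) ⟨2 ^ n + j, add_lt_two_pow_succ j.isLt⟩)) =
        MvPolynomial.eval (Fin.snoc α'' ((ω ^ (ℓ : ℕ) * α) ^ (2 ^ n * (d + 1) * w ^ 2)) :
            Fin (n + 1) → K)
          (fsGenCoord n w (d + 1) ω β (binaryOrder n j)) := by
      intro α ℓ j
      rw [eval_fsGenCoord_succ_node n w (d + 1) ω β hβ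
        (binaryOrder (n + 1) ⟨2 ^ n + j, add_lt_two_pow_succ j.isLt⟩) (binaryOrder n j)
        (fun i => (binaryOrder_succ_upper j i).symm) α'' (ω⁻¹ * α) ℓ,
        if_neg (by rw [binaryOrder_succ_upper_last j]; exact one_ne_zero), pow_succ, mul_assoc,
        mul_inv_cancel_left₀ hω0]
    -- node properties of `U_α(z) = ∏_j M_{(j,0)}(𝒢^{(n+1)}_{(j,0)}(α'', ω⁻¹α, z))`, `V_α` likewise
    have hUnode : ∀ (t : ι) (α : K) (ℓ : Fin (w ^ 2)),
        (List.ofFn fun j : Fin (2 ^ n) => (Ms t ⟨j, lt_two_pow_succ j.isLt⟩).map (Polynomial.eval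
          (MvPolynomial.eval
            (Fin.snoc (Fin.snoc α'' (ω⁻¹ * α) : Fin (n + 1) → K) (β ℓ) : Fin (n + 2) → K)
            (fsGenCoord (n + 1) w (d + 1) ω β
              (binaryOrder (n + 1) ⟨j, lt_two_pow_succ j.isLt⟩))))).prod =
        (Rf t).map (Polynomial.eval (ω ^ (ℓ : ℕ) * α)) := by
      intro t α ℓ
      rw [hReval]
      exact congrArg (fun F : Fin (2 ^ n) → Matrix (Fin w) (Fin w) K => (List.ofFn F).prod)
        (funext fun j => by rw [hnode0 α ℓ j])
    have hVnode : ∀ (t : ι) (α : K) (ℓ : Fin (w ^ 2)),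
        (List.ofFn fun j : Fin (2 ^ n) => (Ms t ⟨2 ^ n + j, add_lt_two_pow_succ j.isLt⟩).map
          (Polynomial.eval (MvPolynomial.eval
            (Fin.snoc (Fin.snoc α'' (ω⁻¹ * α) : Fin (n + 1) → K) (β ℓ) : Fin (n + 2) → K)
            (fsGenCoord (n + 1) w (d + 1) ω β
              (binaryOrder (n + 1) ⟨2 ^ n + j, add_lt_two_pow_succ j.isLt⟩))))).prod =
        (Tf t).map (Polynomial.eval ((ω ^ (ℓ : ℕ) * α) ^ (2 ^ n * (d + 1) * w ^ 2))) := by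
      intro t α ℓ
      rw [hTeval]
      exact congrArg (fun F : Fin (2 ^ n) → Matrix (Fin w) (Fin w) K => (List.ofFn F).prod)
        (funext fun j => by rw [hnode1 α ℓ j])
    -- the bad values of the new twisted seed are finite for each member of the family
    have hBadfin : ∀ t, Set.Finite {α : K | ¬ Submodule.span K (Set.range fun xy : K × K =>
        (Rf t).map (Polynomial.eval xy.1) * (Tf t).map (Polynomial.eval xy.2)) ≤
      Submodule.span K (Set.range fun z : K =>
        (List.ofFn fun j : Fin (2 ^ n) => (Ms t ⟨j, lt_two_pow_succ j.isLt⟩).map (Polynomial.eval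
          (MvPolynomial.eval
            (Fin.snoc (Fin.snoc α'' (ω⁻¹ * α) : Fin (n + 1) → K) z : Fin (n + 2) → K)
            (fsGenCoord (n + 1) w (d + 1) ω β
              (binaryOrder (n + 1) ⟨j, lt_two_pow_succ j.isLt⟩))))).prod *
        (List.ofFn fun j : Fin (2 ^ n) => (Ms t ⟨2 ^ n + j, add_lt_two_pow_succ j.isLt⟩).map
          (Polynomial.eval (MvPolynomial.eval
            (Fin.snoc (Fin.snoc α'' (ω⁻¹ * α) : Fin (n + 1) → K) z : Fin (n + 2) → K)
            (fsGenCoord (n + 1) w (d + 1) ω β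
              (binaryOrder (n + 1) ⟨2 ^ n + j, add_lt_two_pow_succ j.isLt⟩))))).prod)} := by
      intro t
      refine set_finite_of_card_lt
        (B := ((2 ^ n * (d + 1) * w ^ 2) * (2 ^ n * (d + 1) * w ^ 2)) * (w * w)) _ fun S hS => ?_
      exact card_lt_of_not_span_evalProd_le hω' (Rf t) (Tf t) (hRdeg t) (hTdeg t) hw _ _
        (fun i : Fin (w * w) => β (Fin.cast (pow_two w).symm i))
        (fun α ℓ => hUnode t α (Fin.cast (pow_two w).symm ℓ))
        (fun α ℓ => hVnode t α (Fin.cast (pow_two w).symm ℓ)) S fun α hα => hS hα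
    obtain ⟨α, hα⟩ :=
      Infinite.exists_notMem_finset (Set.Finite.toFinset (Set.finite_iUnion hBadfin))
    have hgood : ∀ t, Submodule.span K (Set.range fun xy : K × K =>
        (Rf t).map (Polynomial.eval xy.1) * (Tf t).map (Polynomial.eval xy.2)) ≤
      Submodule.span K (Set.range fun z : K =>
        (List.ofFn fun j : Fin (2 ^ n) => (Ms t ⟨j, lt_two_pow_succ j.isLt⟩).map (Polynomial.eval
          (MvPolynomial.eval
            (Fin.snoc (Fin.snoc α'' (ω⁻¹ * α) : Fin (n + 1) → K) z : Fin (n + 2) → K)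
            (fsGenCoord (n + 1) w (d + 1) ω β
              (binaryOrder (n + 1) ⟨j, lt_two_pow_succ j.isLt⟩))))).prod *
        (List.ofFn fun j : Fin (2 ^ n) => (Ms t ⟨2 ^ n + j, add_lt_two_pow_succ j.isLt⟩).map
          (Polynomial.eval (MvPolynomial.eval
            (Fin.snoc (Fin.snoc α'' (ω⁻¹ * α) : Fin (n + 1) → K) z : Fin (n + 2) → K)
            (fsGenCoord (n + 1) w (d + 1) ω β
              (binaryOrder (n + 1) ⟨2 ^ n + j, add_lt_two_pow_succ j.isLt⟩))))).prod) := by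
      intro t
      by_contra h
      exact hα (by rw [Set.Finite.mem_toFinset, Set.mem_iUnion]; exact ⟨t, h⟩)
    -- assemble
    refine ⟨Fin.snoc α'' (ω⁻¹ * α), fun t => ?_⟩
    rw [Submodule.span_le]
    rintro _ ⟨x, rfl⟩
    rw [SetLike.mem_coe]
    have hsplit := listProd_ofFn_two_pow_succ (fun j => (Ms t j).map (Polynomial.eval (x j)))
    rw [show (fun x : Fin (2 ^ (n + 1)) → K =>
        (List.ofFn fun j => (Ms t j).map (Polynomial.eval (x j))).prod) x =
        (List.ofFn fun j => (Ms t j).map (Polynomial.eval (x j))).prod from rfl, hsplit]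
    -- each half lies in the span of the values of `R` resp. `T`
    have h0 : (List.ofFn fun j : Fin (2 ^ n) => (Ms t ⟨j, lt_two_pow_succ j.isLt⟩).map
        (Polynomial.eval (x ⟨j, lt_two_pow_succ j.isLt⟩))).prod ∈
        Submodule.span K (Set.range fun s : K => (Rf t).map (Polynomial.eval s)) := by
      have h := hα'' (Sum.inl t)
        (Submodule.subset_span ⟨fun j => x ⟨j, lt_two_pow_succ j.isLt⟩, rfl⟩)
      simp only [Sum.elim_inl] at h
      have hEq : (fun s : K => (Rf t).map (Polynomial.eval s)) = fun s : K =>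
          (List.ofFn fun j => (Ms t ⟨j, lt_two_pow_succ j.isLt⟩).map (Polynomial.eval
            (MvPolynomial.eval (Fin.snoc α'' s : Fin (n + 1) → K)
              (fsGenCoord n w (d + 1) ω β (binaryOrder n j))))).prod :=
        funext fun s => hReval t s
      rw [hEq]
      exact h
    have h1 : (List.ofFn fun j : Fin (2 ^ n) => (Ms t ⟨2 ^ n + j, add_lt_two_pow_succ j.isLt⟩).map
        (Polynomial.eval (x ⟨2 ^ n + j, add_lt_two_pow_succ j.isLt⟩))).prod ∈
        Submodule.span K (Set.range fun s : K => (Tf t).map (Polynomial.eval s)) := by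
      have h := hα'' (Sum.inr t)
        (Submodule.subset_span ⟨fun j => x ⟨2 ^ n + j, add_lt_two_pow_succ j.isLt⟩, rfl⟩)
      simp only [Sum.elim_inr] at h
      have hEq : (fun s : K => (Tf t).map (Polynomial.eval s)) = fun s : K =>
          (List.ofFn fun j => (Ms t ⟨2 ^ n + j, add_lt_two_pow_succ j.isLt⟩).map (Polynomial.eval
            (MvPolynomial.eval (Fin.snoc α'' s : Fin (n + 1) → K)
              (fsGenCoord n w (d + 1) ω β (binaryOrder n j))))).prod :=
        funext fun s => hTeval t s
      rw [hEq]
      exact h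
    have h01 := Submodule.mul_mem_mul h0 h1
    rw [Submodule.span_mul_span] at h01
    have hsub : Set.range (fun s : K => (Rf t).map (Polynomial.eval s)) *
        Set.range (fun s : K => (Tf t).map (Polynomial.eval s)) ⊆
        Set.range (fun xy : K × K =>
          (Rf t).map (Polynomial.eval xy.1) * (Tf t).map (Polynomial.eval xy.2)) := by
      rintro _ ⟨_, ⟨s₁, rfl⟩, _, ⟨s₂, rfl⟩, rfl⟩
      exact ⟨(s₁, s₂), rfl⟩
    have h2 := hgood t (Submodule.span_mono hsub h01)
    refine (Submodule.span_mono ?_) h2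
    rintro _ ⟨z, rfl⟩
    refine ⟨z, ?_⟩
    exact listProd_ofFn_two_pow_succ (fun j : Fin (2 ^ (n + 1)) => (Ms t j).map
      (Polynomial.eval (MvPolynomial.eval
        (Fin.snoc (Fin.snoc α'' (ω⁻¹ * α) : Fin (n + 1) → K) z : Fin (n + 2) → K)
        (fsGenCoord (n + 1) w (d + 1) ω β (binaryOrder (n + 1) j)))))

/-- **[ForbesShpilka2013, Lemma 19 (arXiv) "The generator preserves span"], as printed (for FSV's
(7.1) with the safe degree parameter, over an infinite field):**
`span{∏_j M_j(x_j)}_{x ∈ K^{2ⁿ}} = span{∏_j M_j(𝒢^{(n)}_j(α))}_{α ∈ K^{n+1}}`.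
[cite: ForbesShpilka2013, Lemma 19 (arXiv numbering; §3.2)] locator: paper:arxiv-1209.2408 p0016.txt:L31–L37 -/
theorem span_layerProd_eq_span_generator [Infinite K] {w d : ℕ} (hw : 0 < w) {ω : K} (hω0 : ω ≠ 0)
    {β : Fin (w ^ 2) → K} (hβ : Function.Injective β) (n : ℕ)
    (hω : Set.InjOn (fun k : ℕ => ω ^ k)
      (Set.Iio ((2 ^ n * (d + 1) * w ^ 2) * (2 ^ n * (d + 1) * w ^ 2))))
    (M : Fin (2 ^ n) → Matrix (Fin w) (Fin w) (Polynomial K)) (hM : ∀ j a b, (M j a b).natDegree ≤ d) :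
    Submodule.span K (Set.range fun x : Fin (2 ^ n) → K =>
        (List.ofFn fun j => (M j).map (Polynomial.eval (x j))).prod) =
      Submodule.span K (Set.range fun α : Fin (n + 1) → K =>
        (List.ofFn fun j => (M j).map (Polynomial.eval
          (MvPolynomial.eval α (fsGenCoord n w (d + 1) ω β (binaryOrder n j))))).prod) := by
  apply le_antisymm
  · obtain ⟨α', hα'⟩ := span_layerProd_le_span_lastSeed hw hω0 hβ n hω Unit (fun _ => M)
      (fun _ => hM)
    refine (hα' ()).trans (Submodule.span_mono ?_)
    rintro _ ⟨s, rfl⟩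
    exact ⟨Fin.snoc α' s, rfl⟩
  · refine Submodule.span_mono ?_
    rintro _ ⟨α, rfl⟩
    exact ⟨fun j => MvPolynomial.eval α (fsGenCoord n w (d + 1) ω β (binaryOrder n j)), rfl⟩

end FS2013

end Literature.Computability.AlgebraicComplexity
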